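import Literature.Probability.Percolation.KozmaNitzanPinning
import Summits.CriticalPhenomena.PercolationContinuityZ3.Theorems.PercNearOneGluingAdditiveGluing
import HarnessLib

/-!
# F6 (generic), part 6 — the ADDITIVE gluing inequality transported to finitely supported weightings on a countable vertex type, with a
# target SET (NEG-SCOPE §B.19 (Q′-1), first half; design owner p3-g11)

builds on p205010 (kernel theorem, internal audit signed; external expert review pending) through `AdditiveGluing_proof`
(= `CSH.additiveGluing_holds`, the crux `AdditiveGluing` of route `PercNearOneGluing`, stmt-CriticalPhenomena-4576, CLOSED).
Lane `prim-bschramm`, seat `prim-bschramm-p3` (gen 11; N1 design owner); helper file (`--supports stmt-CriticalPhenomena-4575`).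

The tree's additive gluing theorem is typed over `Fin n` with one target vertex `b`:
`(∀ a ∈ A, 1 − t ≤ P(a ↔ b)) ⟹ P(o ↔ A) − t ≤ P(o ↔ b)` (`t ≥ 0`).  Kozma–Nitzan's Step V needs it in the pinned weightings `K_ξ` of a
countable graph, with a target SET `T` ("identify `T` to a point", KN p. 22).  This file transports it exactly as
`Literature/…/KozmaNitzanPinning` transports Conjecture 3 (`.fintype` by relabelling, `.finSupp` by the restriction coupling to the finite
support, `.openConn_set` by wiring the target set), the inequality being preserved line by line because the three probabilities are
transported by EQUALITIES and `P(o ↔ A)` only grows under wiring: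
* `additiveGluing_fintype`, `additiveGluing_finSupp`, `additiveGluing_openConn_set` — the three transports of ANY proof of `AdditiveGluing`;
* **`additiveGluingSchema_KN`** — the finitely-supported, target-set, SOURCE-ADDITIVE schema on every countable `V`, unconditional (from
  `AdditiveGluing_proof`); `additiveGluingSchema_KN_in` — relays reliable inside a region `Rg`.
The schema is LINEAR and ADDITIVE IN THE SOURCE: this is what lets Lemma 10 be stated without a source hypothesis (part 7) and the
corridor chains be composed without nesting accuracies (`KNLevels.AdditiveTargetPropertyUP.chain_edge_additive`, part 5).
[cite: KozmaNitzan2024, Conjecture 1 (p. 3), Conjecture 3 (p. 15), §4 p. 22 ("we identified the set T to a point")] [this work]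
-/

noncomputable section

open MeasureTheory ProbabilityTheory
open scoped ENNReal

namespace Summit.CriticalPhenomena.PercolationContinuityZ3.Theorems

namespace Transplant

namespace KNLevels

open Literature.Probability.Percolation Literature.Probability.LatticeModels SimpleGraph
open Summit.CriticalPhenomena.PercolationContinuityZ3.Theses.PercNearOneGluing (AdditiveGluing)

/-! ## §1 The schema (stated inline — no definition, so that this file and its consumers stay in the proof lane)

The ADDITIVE GLUING SCHEMA on a vertex type `V` is the sentence: for every weighting `w` vanishing off the pairs of a finite set `Sf`, every
relay set `A ⊆ Sf`, target set `∅ ≠ T ⊆ Sf`, source `o ∈ Sf` and slack `t ≥ 0`, if every relay is joined to `T` with probability `≥ 1 − t`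
then `P_w(o ↔ A) − t ≤ P_w(o ↔ T)`.  It is written out in full in `additiveGluing_openConn_set` / `additiveGluingSchema_KN` below and taken
in the same explicit shape by the Step-V twin (part 7), exactly as `LHyp.stepV_in` takes Conjecture 3. -/

/-! ## §2 The three transports of the `Fin n` inequality -/

variable {V : Type}

/-- **Additive gluing over every finite vertex type** (relabel along `Fintype.equivFin`; twin of `KozmaNitzan2024_conjecture3.fintype`).
[cite: KozmaNitzan2024, Conjecture 1 (p. 3)] -/
theorem additiveGluing_fintype (hAG : AdditiveGluing) (V : Type) [Fintype V] (w : Sym2 V → unitInterval) (A : Finset V) (o b : V)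
    (t : ℝ) (ht : 0 ≤ t) (hab : ∀ a ∈ A, 1 - t ≤ (prodBernoulli w).real (openConn a b)) :
    (prodBernoulli w).real (⋃ a ∈ A, openConn o a) - t ≤ (prodBernoulli w).real (openConn o b) := by
  classical
  set e := Fintype.equivFin V with he
  have hf : Function.Injective (e.symm : Fin (Fintype.card V) → V) := e.symm.injective
  set w' : Sym2 (Fin (Fintype.card V)) → unitInterval := w ∘ Sym2.map e.symm with hw'
  have hmap := prodBernoulli_map_restrictConfig w hf
  -- transport of the three probabilities
  have key : ∀ x y : V, (prodBernoulli w').real (openConn (e x) (e y)) = (prodBernoulli w).real (openConn x y) := by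
    intro x y
    rw [hw', ← hmap, map_measureReal_apply (measurable_restrictConfig _) (measurableSet_openConn_holds _ _),
      restrictConfig_symm_preimage_openConn]
  have keyU : (prodBernoulli w').real (⋃ a ∈ A.map e.toEmbedding, openConn (e o) a) =
      (prodBernoulli w).real (⋃ a ∈ A, openConn o a) := by
    rw [hw', ← hmap, map_measureReal_apply (measurable_restrictConfig _)
      (Finset.measurableSet_biUnion _ fun a _ => measurableSet_openConn_holds _ _)]
    congr 1
    exact restrictConfig_symm_preimage_biUnion_openConn e o A
  have h1 := hAG (Fintype.card V) w' (A.map e.toEmbedding) (e o) (e b) t ht (by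
    intro a ha
    rw [Finset.mem_map_equiv] at ha
    have := hab (e.symm a) ha
    rwa [← key, Equiv.apply_symm_apply] at this)
  rwa [key, keyU] at h1

/-- **Additive gluing for finitely supported weights on a countable vertex type** (restriction coupling to the finite graph on the support
`S`, on which the configuration a.s. lives; twin of `KozmaNitzan2024_conjecture3.finSupp`). [cite: KozmaNitzan2024, Conjecture 1 (p. 3)] -/
theorem additiveGluing_finSupp (hAG : AdditiveGluing) (V : Type) [Countable V] (w : Sym2 V → unitInterval) (S : Finset V)
    (hw : ∀ e : Sym2 V, (∃ x ∈ e, x ∉ S) → w e = 0) (A : Finset V) (o b : V) (hAS : A ⊆ S) (ho : o ∈ S) (hb : b ∈ S)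
    (t : ℝ) (ht : 0 ≤ t) (hab : ∀ a ∈ A, 1 - t ≤ (prodBernoulli w).real (openConn a b)) :
    (prodBernoulli w).real (⋃ a ∈ A, openConn o a) - t ≤ (prodBernoulli w).real (openConn o b) := by
  classical
  set Sset : Set V := ↑S with hSset
  set f : Sset → V := Subtype.val with hf
  have hfi : Function.Injective f := Subtype.val_injective
  set w' : Sym2 Sset → unitInterval := w ∘ Sym2.map f with hw'
  have hmap := prodBernoulli_map_restrictConfig w hfi
  -- a.s. every open pair lies inside `S`
  have hae : ∀ᵐ ω ∂prodBernoulli w, ∀ e ∈ ω, ∀ x ∈ e, x ∈ Sset := by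
    have hZ : ({e : Sym2 V | ∃ x ∈ e, x ∉ S}).Countable := Set.to_countable _
    filter_upwards [prodBernoulli_ae_forall_notMem w hZ fun e he => hw e he] with ω hω e he x hx
    by_contra hxS
    exact hω e ⟨x, hx, hxS⟩ he
  -- transport of connection probabilities
  have key : ∀ (x y : V) (hx : x ∈ Sset) (hy : y ∈ Sset),
      (prodBernoulli w').real (openConn (⟨x, hx⟩ : Sset) ⟨y, hy⟩) = (prodBernoulli w).real (openConn x y) := by
    intro x y hx hy
    rw [hw', ← hmap, map_measureReal_apply (measurable_restrictConfig _) (measurableSet_openConn_holds _ _)]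
    refine measureReal_congr ?_
    filter_upwards [hae] with ω hω
    refine propext ⟨fun h' => ?_, fun h' => ?_⟩
    · exact reachable_map_of_restrictConfig hfi ω h'
    · exact reachable_restrictConfig_subtype_of_reachable hω hx hy h'
  set A' : Finset Sset := A.subtype (· ∈ Sset) with hA'
  have keyU : (prodBernoulli w').real (⋃ a ∈ A', openConn (⟨o, ho⟩ : Sset) a) =
      (prodBernoulli w).real (⋃ a ∈ A, openConn o a) := by
    rw [hw', ← hmap, map_measureReal_apply (measurable_restrictConfig _)
      (Finset.measurableSet_biUnion _ fun a _ => measurableSet_openConn_holds _ _)]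
    refine measureReal_congr ?_
    filter_upwards [hae] with ω hω
    change (ω ∈ restrictConfig f ⁻¹' (⋃ a ∈ A', openConn (⟨o, ho⟩ : Sset) a)) =
      (ω ∈ ⋃ a ∈ A, openConn o a)
    simp only [Set.mem_preimage, Set.mem_iUnion, exists_prop, hA', Finset.mem_subtype, eq_iff_iff]
    constructor
    · rintro ⟨a, ha, h'⟩
      exact ⟨a, ha, reachable_map_of_restrictConfig hfi ω h'⟩
    · rintro ⟨a, ha, h'⟩
      exact ⟨⟨a, hAS ha⟩, ha, reachable_restrictConfig_subtype_of_reachable hω ho (hAS ha) h'⟩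
  haveI : Fintype Sset := (S.finite_toSet).fintype
  have h1 := additiveGluing_fintype hAG Sset w' A' ⟨o, ho⟩ ⟨b, hb⟩ t ht (by
    intro a ha
    rw [hA', Finset.mem_subtype] at ha
    have := hab a ha
    rwa [← key a b a.2 hb] at this)
  rwa [key, keyU] at h1

/-- **Additive gluing with a target SET** (wire the target: `P_{wireW T w}(x ↔ t₀) = P_w(x ↔ T)`, and `P(o ↔ A)` only grows under wiring;
twin of `KozmaNitzan2024_conjecture3.openConn_set`). [cite: KozmaNitzan2024, §4 p. 22 ("we identified the set T to a point")] -/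
theorem additiveGluing_openConn_set (hAG : AdditiveGluing) (V : Type) [Countable V] (w : Sym2 V → unitInterval) (S : Finset V)
    (hw : ∀ e : Sym2 V, (∃ x ∈ e, x ∉ S) → w e = 0) (A T : Finset V) (o : V) (t : ℝ) (hAS : A ⊆ S) (hTS : T ⊆ S) (ho : o ∈ S)
    (hT : T.Nonempty) (ht : 0 ≤ t) (haT : ∀ a ∈ A, 1 - t ≤ (prodBernoulli w).real (⋃ t' ∈ T, openConn a t')) :
    (prodBernoulli w).real (⋃ a ∈ A, openConn o a) - t ≤ (prodBernoulli w).real (⋃ t' ∈ T, openConn o t') := by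
  obtain ⟨t₀, ht₀⟩ := hT
  have hw' : ∀ e : Sym2 V, (∃ x ∈ e, x ∉ S) → wireW (↑T : Set V) w e = 0 := by
    intro e he
    rw [wireW_apply_of_not_mem w ?_, hw e he]
    obtain ⟨x, hx, hxS⟩ := he
    exact fun h' => hxS (hTS (h'.1 x hx))
  have h1 := additiveGluing_finSupp hAG V (wireW (↑T : Set V) w) S hw' A o t₀ hAS ho (hTS ht₀) t ht (by
    intro a ha
    rw [prodBernoulli_wireW_real_openConn w (↑T : Set V) (Finset.mem_coe.2 ht₀) a]
    exact haT a ha)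
  rw [prodBernoulli_wireW_real_openConn w (↑T : Set V) (Finset.mem_coe.2 ht₀) o] at h1
  have hmono : (prodBernoulli w).real (⋃ a ∈ A, openConn o a) ≤
      (prodBernoulli (wireW (↑T : Set V) w)).real (⋃ a ∈ A, openConn o a) :=
    prodBernoulli_real_biUnion_openConn_mono (le_wireW (↑T : Set V) w) o _
  have h2 : (prodBernoulli w).real (⋃ a ∈ A, openConn o a) - t ≤
      (prodBernoulli w).real (⋃ t' ∈ (↑T : Set V), openConn o t') := le_trans (by linarith) h1
  simpa only [Finset.mem_coe] using h2

/-! ## §3 The schema, unconditionally -/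

/-- **The additive gluing schema holds on every countable vertex type** — from the tree theorem `AdditiveGluing_proof`
(`CSH.additiveGluing_holds`).  builds on p205010 (kernel theorem, internal audit signed; external expert review pending).
[cite: KozmaNitzan2024, Conjecture 1 (p. 3), Conjecture 3 (p. 15)] [this work] -/
theorem additiveGluingSchema_KN (V : Type) [Countable V] (w : Sym2 V → unitInterval) (S : Finset V)
    (hw : ∀ e : Sym2 V, (∃ x ∈ e, x ∉ S) → w e = 0) (A T : Finset V) (o : V) (t : ℝ) (hAS : A ⊆ S) (hTS : T ⊆ S) (ho : o ∈ S)
    (hT : T.Nonempty) (ht : 0 ≤ t) (haT : ∀ a ∈ A, 1 - t ≤ (prodBernoulli w).real (⋃ t' ∈ T, openConn a t')) :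
    (prodBernoulli w).real (⋃ a ∈ A, openConn o a) - t ≤ (prodBernoulli w).real (⋃ t' ∈ T, openConn o t') :=
  additiveGluing_openConn_set AdditiveGluing_proof V w S hw A T o t hAS hTS ho hT ht haT

/-- **The schema with relays reliable to the target INSIDE a region** (the form Step V consumes, `Rg = D ∌ o`): monotonicity
`openConnIn Rg ⊆ openConn`.  Unconditional (from `additiveGluingSchema_KN`). [folklore] -/
theorem additiveGluingSchema_KN_in {V : Type} [Countable V] (w : Sym2 V → unitInterval)
    (Sf : Finset V) (hw : ∀ e : Sym2 V, (∃ x ∈ e, x ∉ Sf) → w e = 0) (A T : Finset V) (o : V) (Rg : Set V) (t : ℝ)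
    (hA : A ⊆ Sf) (hT : T ⊆ Sf) (ho : o ∈ Sf) (hne : T.Nonempty) (ht : 0 ≤ t)
    (haT : ∀ a ∈ A, 1 - t ≤ (prodBernoulli w).real (⋃ t' ∈ T, openConnIn Rg a t')) :
    (prodBernoulli w).real (⋃ a ∈ A, openConn o a) - t ≤ (prodBernoulli w).real (⋃ t' ∈ T, openConn o t') := by
  refine additiveGluingSchema_KN V w Sf hw A T o t hA hT ho hne ht fun a ha => (haT a ha).trans ?_
  refine measureReal_mono ?_ (measure_ne_top _ _)
  intro ω hω
  simp only [Set.mem_iUnion, exists_prop] at hω ⊢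
  obtain ⟨t', ht', h'⟩ := hω
  exact ⟨t', ht', openConnIn_subset_openConn _ _ _ h'⟩

end KNLevels

end Transplant

end Summit.CriticalPhenomena.PercolationContinuityZ3.Theorems

end
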